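import Summits.BirchSwinnertonDyer.BirchSwinnertonDyer.Theorems.ClassRecordThreeCornerAtThreeChebKummerWitness
import Summits.BirchSwinnertonDyer.BirchSwinnertonDyer.Theorems.ClassRecordThreeCornerAtThreeSplitAuxPrimeOfWitness
import Summits.BirchSwinnertonDyer.BirchSwinnertonDyer.Theorems.ClassRecordThreeCornerAtThreeRingClassThetaOrder
import Summits.BirchSwinnertonDyer.Rank1Residual.Partition.Rows
import Literature.NumberTheory.QuadraticFields.SplitPrimeKummerWitnessOrder
import Literature.NumberTheory.QuadraticFields.RingClassConjugatePrimeClass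
import Literature.NumberTheory.EllipticCurves.RingClassFieldAbelian
import Literature.NumberTheory.EllipticCurves.RingClassFieldClassNumber
import Literature.NumberTheory.EllipticCurves.RingClassFieldSplitting
import Literature.NumberTheory.EllipticCurves.RingClassFieldDecompositionGroup
import Literature.NumberTheory.EllipticCurves.HeegnerPointsOfConductor
import HarnessLib

/-!
# (c′) PROVED — the split prime-conductor Chebotarev–Kummer supply of the corner line at `p = 3` (conjunct 2 of r18/r19 `stub_upper3_residualMulti`)
# (cell `bsd-stepL`, seat `bsd-stepL-corner3-p2` g15 = lane B, LINE OWNER of crux 21420 `CornerAtThreeW`; `--supports stmt-BirchSwinnertonDyer-21420 --as helper`)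

WHAT. `chebotarevKummerSupplyAtThree` is conjunct 2 of the r18/r19 residual stub `stub_upper3_residualMulti` of
`Cruxes/CornerAtThreeW/Lines/inert.lean` VERBATIM: for `E = W/ℚ` on the corner at `3` (`ClassX11b W 3 ∧ ¬ Surj W 3`), `K` imaginary quadratic with
`d_K < −4` and `3` inert, a prime `q` split in `K` (with the line's idle binders `N ≠ 0`, `q ∣ N`, `3 ∣ c_q`), and every `E, m₀` (`m₀` square-free with the
line's binder on its prime factors): there is an odd prime `ℓ₀ ∤ N m₀`, SPLIT in `K`, with `[𝔭]_{m₀} = 1` for both primes `𝔭 ∣ ℓ₀` of `K` (`ℓ₀` splits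
completely in the ring class field `K[m₀]`), `3 ∤ a_{ℓ₀}(E) − 2`, and `3^E ∣ ord [𝔮]_{ℓ₀}` in `Pic(𝒪_{ℓ₀})` for both primes `𝔮 ∣ q`.
HOW (lane B g14 memo CORNER3-G14 §6–§7, all steps now tree theorems): the WITNESS `γ ∈ Γ_ℚ` (g15 `ChebKummerThree.exists_witness`: commutators of
`Γ_K` acting as `−I` on `E[3]` — `ρ̄_{E,3}(Γ_K)` is non-abelian because `3` is multiplicative, `E[3]` irreducible and `3` INERT in `K`; Kummer exclusion for
the cube root of `x = β(τβ)²`, `𝔮^{ord[𝔮]} = (β)`, a non-cube by er5 -w4's `not_exists_pow_eq_kummerWitness`), the CHEBOTAREV STEP (g15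
`exists_splitAuxPrime_of_witness`, over the tree's PROVED `absoluteGaloisGroup.frobenius_dense`), the ring class dictionary (`K[m₀]/K` abelian
`isAbelianGalois_ringClassField`; splitting law `mem_splitPrimes_ringClassField_iff`; conjugate classes `RingClass.primeClass_eq_one_iff_of_smul`), and (D3)
(g14 `RingClassSplit.pow_dvd_orderOf_primeClass_of_not_rational`, transported to `τ𝔮` by `orderOf_primeClass_eq_of_smul`).
HONEST FRAMING: a helper theorem (`--supports 21420 --as helper`); it discharges ONE CONJUNCT of ONE registered stub of the line; the stub's other
conjunct (a) `PrimitivesWithSplitNormTDAtThree` (print-level primitives of the CM family on `X_{N⁺,N⁻}` with the split norm relation) and the line's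
stub (L) remain OPEN; no item closes; 21420 OPEN; no census label moves (T7); BSD is proved for no curve.
References (locators only): [cite: GrossLMS1991, §3, §9] [cite: Cox2013, §7.D, §9.A, Thm. 8.12] [cite: Serre1972, §1.12, §2.4 Prop. 15]
[cite: NeukirchANT1999, Ch. I §9].
presearch: `lit search --hybrid "Chebotarev Kummer auxiliary prime ring class field Kolyvagin p=3"` / galaxy `"Kolyvagin prime|auxiliary prime"`: the
argument is Gross 1991 §3/§9's choice of Frobenius adapted to a SPLIT auxiliary prime and image `N(C)`; no printed statement at `p = 3` with non-surjective
image — assembled here from tree theorems. Axioms: `propext`, `Classical.choice`, `Quot.sound`.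
-/

set_option autoImplicit false
set_option linter.dupNamespace false -- `Summit.BirchSwinnertonDyer.BirchSwinnertonDyer` (summit = problem), tree-wide

noncomputable section

open scoped Classical Pointwise NumberField nonZeroDivisors
open WeierstrassCurve NumberField IsDedekindDomain Field
open Literature.NumberTheory.GaloisRepresentations Literature.NumberTheory.EllipticCurves
open Literature.NumberTheory.EllipticCurves.Rank1Residual
open Literature.NumberTheory.NumberFields Literature.NumberTheory.NumberFields.RingClassField
open Literature.NumberTheory.QuadraticFields Literature.NumberTheory.QuadraticFields.RingClass
open Summit.BirchSwinnertonDyer.Rank1Residual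

namespace Summit.BirchSwinnertonDyer.BirchSwinnertonDyer.Theorems.ChebKummerThree

/-! ### §1 Plumbing -/

/-- Two distinct rational primes are not both in a proper ideal. [folklore] -/
theorem natCast_not_mem_of_natCast_mem {K : Type} [Field K] [NumberField K] {I : Ideal (𝓞 K)} (hI : I ≠ ⊤)
    {a b : ℕ} (ha : a.Prime) (hb : b.Prime) (hab : a ≠ b) (haI : (a : 𝓞 K) ∈ I) : (b : 𝓞 K) ∉ I := by
  intro hbI
  have hcop : IsCoprime (a : ℤ) (b : ℤ) := Nat.isCoprime_iff_coprime.mpr ((Nat.coprime_primes ha hb).mpr hab)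
  obtain ⟨u, v, huv⟩ := hcop
  apply hI
  rw [Ideal.eq_top_iff_one]
  have h1 : ((u : 𝓞 K) * a + (v : 𝓞 K) * b) = 1 := by exact_mod_cast congrArg (Int.cast : ℤ → 𝓞 K) huv
  rw [← h1]
  exact I.add_mem (I.mul_mem_left _ haI) (I.mul_mem_left _ hbI)

/-- A prime `ℓ ∤ m` in a prime ideal keeps `m` out of it: `¬ m𝓞_K ≤ 𝔭` for `ℓ ∈ 𝔭`. [folklore] -/
theorem not_span_le_of_natCast_mem {K : Type} [Field K] [NumberField K] (v : HeightOneSpectrum (𝓞 K))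
    {ℓ m : ℕ} (hℓ : ℓ.Prime) (hℓm : ¬ ℓ ∣ m) (hℓv : (ℓ : 𝓞 K) ∈ v.asIdeal) :
    ¬ Ideal.span {(m : 𝓞 K)} ≤ v.asIdeal := by
  intro hle
  have hm : (m : 𝓞 K) ∈ v.asIdeal := hle (Ideal.mem_span_singleton_self _)
  have hcop : IsCoprime (ℓ : ℤ) (m : ℤ) := Nat.isCoprime_iff_coprime.mpr ((Nat.Prime.coprime_iff_not_dvd hℓ).mpr hℓm)
  obtain ⟨u, w, huw⟩ := hcop
  apply v.isPrime.ne_top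
  rw [Ideal.eq_top_iff_one]
  have h1 : ((u : 𝓞 K) * ℓ + (w : 𝓞 K) * m) = 1 := by exact_mod_cast congrArg (Int.cast : ℤ → 𝓞 K) huw
  rw [← h1]
  exact v.asIdeal.add_mem (v.asIdeal.mul_mem_left _ hℓv) (v.asIdeal.mul_mem_left _ hm)

/-- A prime of `𝓞_K` containing the rational prime `q` lies over `(q) ⊂ ℤ`. [folklore] -/
theorem under_int_eq_span_of_natCast_mem {K : Type} [Field K] [NumberField K] {q : ℕ} (hq : q.Prime)
    {P : Ideal (𝓞 K)} [P.IsPrime] (hqP : (q : 𝓞 K) ∈ P) : P.under ℤ = Ideal.span {(q : ℤ)} := by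
  have hmax : (Ideal.span {(q : ℤ)}).IsMaximal :=
    PrincipalIdealRing.isMaximal_of_irreducible (Nat.prime_iff_prime_int.mp hq).irreducible
  refine (hmax.eq_of_le (Ideal.IsPrime.under ℤ P).ne_top ?_).symm
  rw [Ideal.span_singleton_le_iff_mem, Ideal.mem_comap, map_natCast]
  exact hqP

/-- Any two primes of a quadratic field containing the same rational prime are Galois conjugate. [folklore] -/
theorem exists_smul_asIdeal_eq {K : Type} [Field K] [NumberField K] (h2 : Module.finrank ℚ K = 2) {q : ℕ} (hq : q.Prime)
    {v w : HeightOneSpectrum (𝓞 K)} (hqv : (q : 𝓞 K) ∈ v.asIdeal) (hqw : (q : 𝓞 K) ∈ w.asIdeal) :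
    ∃ σ : K ≃ₐ[ℚ] K, w.asIdeal = σ • v.asIdeal := by
  haveI : Algebra.IsQuadraticExtension ℚ K := ⟨h2⟩
  haveI : IsGaloisGroup (K ≃ₐ[ℚ] K) ℤ (𝓞 K) := IsGaloisGroup.of_isFractionRing (K ≃ₐ[ℚ] K) ℤ (𝓞 K) ℚ K
  haveI := v.isPrime
  haveI := w.isPrime
  have hunder : v.asIdeal.under ℤ = w.asIdeal.under ℤ := by
    rw [under_int_eq_span_of_natCast_mem hq hqv, under_int_eq_span_of_natCast_mem hq hqw]
  haveI : v.asIdeal.LiesOver (v.asIdeal.under ℤ) := ⟨rfl⟩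
  haveI : w.asIdeal.LiesOver (v.asIdeal.under ℤ) := ⟨hunder⟩
  obtain ⟨σ, hσ⟩ := Ideal.exists_smul_eq_of_isGaloisGroup (v.asIdeal.under ℤ) v.asIdeal w.asIdeal (K ≃ₐ[ℚ] K)
  exact ⟨σ, hσ.symm⟩

/-! ### §2 (c′) -/

/-- **(c′) — the split prime-conductor Chebotarev–Kummer supply at `p = 3`, conjunct 2 of r18/r19 `stub_upper3_residualMulti` of
`Cruxes/CornerAtThreeW/Lines/inert.lean`, PROVED** (statement verbatim; proof in the module docstring).
[cite: GrossLMS1991, §3, §9] [cite: Cox2013, §7.D, §9.A, Thm. 8.12] [cite: Serre1972, §1.12, §2.4 Prop. 15] -/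
theorem chebotarevKummerSupplyAtThree :
    ∀ (W : WeierstrassCurve ℚ) [W.IsElliptic] [W.IsGloballyMinimal] (K : Type) [Field K] [NumberField K] (ι : K →+* ℂ)
      [∀ j : ℕ, NumberField (ringClassField K ι j)],
      IsImaginaryQuadratic K → NumberField.discr K < -4 →
      ((Ideal.span {(3 : ℤ)}).primesOver (𝓞 K)).ncard = 1 → ¬ (3 : ℤ) ∣ NumberField.discr K →
      ClassX11b W 3 → ¬ Surj W 3 →
      ∀ (q N : ℕ) [Fact q.Prime], ((Ideal.span {(q : ℤ)}).primesOver (𝓞 K)).ncard = 2 → N ≠ 0 → q ∣ N →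
      3 ∣ (W.baseChange ℚ_[q]).localTamagawaNumber ℤ_[q] →
      ∀ E m₀ : ℕ, Squarefree m₀ → (∀ r ∈ m₀.primeFactors, ¬ r ∣ N ∧ (Ideal.span {(r : 𝓞 K)}).IsPrime) →
        ∃ ℓ₀ : ℕ, ℓ₀.Prime ∧ ℓ₀ ≠ 2 ∧ ¬ ℓ₀ ∣ N ∧ ¬ ℓ₀ ∣ m₀ ∧ ((Ideal.span {(ℓ₀ : ℤ)}).primesOver (𝓞 K)).ncard = 2 ∧
          (∀ v : HeightOneSpectrum (𝓞 K), ((ℓ₀ : ℕ) : 𝓞 K) ∈ v.asIdeal → Literature.NumberTheory.NumberFields.RingClassField.primeClass m₀ v = 1) ∧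
          ¬ (3 : ℤ) ∣ W.frobeniusTrace ℓ₀ - 2 ∧
          ∀ v : HeightOneSpectrum (𝓞 K), ((q : ℕ) : 𝓞 K) ∈ v.asIdeal → 3 ^ E ∣ orderOf (Literature.NumberTheory.NumberFields.RingClassField.primeClass ℓ₀ v) := by
  intro W _ _ K _ _ ι _ hK hdK h3 h3d hX hns q N _ hq2 hN _ _ E m₀ hm₀ _
  classical
  have hq : q.Prime := Fact.out
  have hm₀0 : m₀ ≠ 0 := hm₀.ne_zero
  haveI : Algebra.IsQuadraticExtension ℚ K := ⟨hK.1⟩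
  haveI : IsGalois ℚ K := inferInstance
  haveI : IsGaloisGroup (K ≃ₐ[ℚ] K) ℤ (𝓞 K) := IsGaloisGroup.of_isFractionRing (K ≃ₐ[ℚ] K) ℤ (𝓞 K) ℚ K
  have hG : Nat.card (K ≃ₐ[ℚ] K) = 2 := by rw [IsGalois.card_aut_eq_finrank, hK.1]
  -- the corner inputs at `3`
  have hmult : W.HasMultiplicativeReductionAtPrime 3 := hX.2.2.1
  have hirr : W.HasIrreducibleModPGaloisRep 3 := hX.2.2.2
  -- the ring class field `R = K[m₀]`: finite abelian Galois over `K`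
  set R := ringClassField K ι m₀ with hRdef
  haveI : FiniteDimensional K R := (finiteDimensional_and_isGalois_ringClassField hK ι hm₀0).1
  haveI : IsAbelianGalois K R := isAbelianGalois_ringClassField hK ι hm₀0
  -- the exponent `E' = max E 1`
  set E' := max E 1 with hE'
  have hE'1 : 1 ≤ E' := le_max_right _ _
  have hEE' : 3 ^ E ∣ 3 ^ E' := pow_dvd_pow 3 (le_max_left _ _)
  haveI : NeZero (3 ^ E') := ⟨pow_ne_zero _ three_ne_zero⟩
  obtain ⟨ζ, hζ⟩ := HasEnoughRootsOfUnity.exists_primitiveRoot (AlgebraicClosure ℚ) (3 ^ E')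
  obtain ⟨e, he⟩ := exists_mem_range_absGaloisRestrict_iff ℚ K
  -- ### the Kummer base: `τ ≠ 1`, `𝔮 ∋ q` with `τ𝔮 ≠ 𝔮`, `𝔮^{ord[𝔮]} = (β)`
  -- adapted from Literature/NumberTheory/QuadraticFields/SplitPrimeKummerWitnessOrder.lean (`exists_splitPrimeKummerWitness`)
  obtain ⟨τ, hτ⟩ : ∃ τ : K ≃ₐ[ℚ] K, τ ≠ 1 := by
    by_contra hall
    push Not at hall
    haveI : Subsingleton (K ≃ₐ[ℚ] K) := ⟨fun a b => by rw [hall a, hall b]⟩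
    have : Nat.card (K ≃ₐ[ℚ] K) = 1 := Nat.card_of_subsingleton 1
    omega
  set qZ : Ideal ℤ := Ideal.span {(q : ℤ)} with hqZ
  obtain ⟨Q, hQ⟩ : (qZ.primesOver (𝓞 K)).Nonempty := Set.nonempty_of_ncard_ne_zero (by rw [hq2]; norm_num)
  haveI := hQ.1
  haveI := hQ.2
  have hqZ0 : qZ ≠ ⊥ := by rw [hqZ, Ne, Ideal.span_singleton_eq_bot]; exact_mod_cast hq.ne_zero
  have hQ0 : Q ≠ ⊥ := Ideal.ne_bot_of_liesOver_of_ne_bot hqZ0 Q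
  let 𝔮 : HeightOneSpectrum (𝓞 K) := ⟨Q, hQ.1, hQ0⟩
  have hq𝔮 : (q : 𝓞 K) ∈ 𝔮.asIdeal := by
    have h1 : algebraMap ℤ (𝓞 K) (q : ℤ) ∈ Q := by
      rw [← Ideal.mem_comap, ← Ideal.under_def, ← Ideal.over_def Q qZ, hqZ]
      exact Ideal.mem_span_singleton_self _
    simpa using h1
  have hne : τ • 𝔮.asIdeal ≠ 𝔮.asIdeal := by
    intro hfix
    have hall : qZ.primesOver (𝓞 K) = {Q} := by
      ext Q'
      simp only [Set.mem_singleton_iff]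
      constructor
      · intro hQ'
        haveI := hQ'.1
        haveI := hQ'.2
        obtain ⟨σ, rfl⟩ := Ideal.exists_smul_eq_of_isGaloisGroup qZ Q Q' (K ≃ₐ[ℚ] K)
        rcases eq_one_or_eq_of_card_eq_two hG hτ σ with h1 | h1
        · rw [h1, one_smul]
        · rw [h1]; exact hfix
      · rintro rfl; exact hQ
    have : (qZ.primesOver (𝓞 K)).ncard = 1 := by rw [hall, Set.ncard_singleton]
    omega
  set I : (Ideal (𝓞 K))⁰ := ⟨𝔮.asIdeal, mem_nonZeroDivisors_iff_ne_zero.mpr 𝔮.ne_bot⟩ with hI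
  set h := orderOf (ClassGroup.mk0 I) with hh
  have h1 : ClassGroup.mk0 (I ^ h) = 1 := by rw [map_pow, hh, pow_orderOf_eq_one]
  have hprinc : (𝔮.asIdeal ^ h).IsPrincipal := by
    have h' := (ClassGroup.mk0_eq_one_iff (I ^ h).2).mp h1
    rwa [SubmonoidClass.coe_pow] at h'
  obtain ⟨β, hβ⟩ := hprinc
  have hβ' : 𝔮.asIdeal ^ h = Ideal.span {β} := hβ
  -- `x = β (τβ)²` is not a cube in `K` (its square is -w4's Kummer witness `(τβ)⁴ β²`)
  set x : 𝓞 K := β * (τ • β) ^ 2 with hxdef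
  have hx : ∀ y : K, y ^ 3 ≠ ((x : 𝓞 K) : K) := by
    intro y hy
    have hw := not_exists_pow_eq_kummerWitness hK.1 τ hτ 𝔮 hne hβ' Nat.prime_three le_rfl (y ^ 2)
    apply hw
    have e1 : ((((τ • β) ^ (3 + 1) * β ^ (3 - 1) : 𝓞 K)) : K) = (((x : 𝓞 K) : K)) ^ 2 := by
      rw [hxdef]; push_cast; ring
    rw [e1, ← hy]; ring
  obtain ⟨α, hα⟩ := IsAlgClosed.exists_pow_nat_eq (e ((x : 𝓞 K) : K)) (by norm_num : 0 < 3)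
  -- ### the witness and the Chebotarev step
  obtain ⟨γ, h1γ, h2γ, h3γ, h4γ⟩ :=
    exists_witness W hmult hirr hns hK h3 h3d e he R hE'1 hζ hx hα
  set T : Finset ℕ := {2, q} ∪ N.primeFactors ∪ m₀.primeFactors with hT
  obtain ⟨ℓ, hℓ, hℓT, hsplit, h3E, haℓ, ⟨w, hℓw, hwR⟩, hkum⟩ :=
    exists_splitAuxPrime_of_witness W hK τ e R hE'1 hζ hα h1γ h2γ h3γ h4γ T
  simp only [hT, Finset.mem_union, Finset.mem_insert, Finset.mem_singleton, Nat.mem_primeFactors, not_or] at hℓT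
  obtain ⟨⟨⟨hℓ2, hℓq⟩, hℓN⟩, hℓm₀⟩ := hℓT
  have hℓN' : ¬ ℓ ∣ N := fun hd ↦ hℓN ⟨hℓ, hd, hN⟩
  have hℓm₀' : ¬ ℓ ∣ m₀ := fun hd ↦ hℓm₀ ⟨hℓ, hd, hm₀0⟩
  refine ⟨ℓ, hℓ, hℓ2, hℓN', hℓm₀', hsplit, ?_, haℓ, ?_⟩
  · -- ### `[𝔭]_{m₀} = 1` for both `𝔭 ∣ ℓ`
    have hwm : ¬ Ideal.span {((m₀ : ℕ) : 𝓞 K)} ≤ w.asIdeal := not_span_le_of_natCast_mem w hℓ hℓm₀' hℓw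
    haveI : IsGalois K (ringClassField K ι m₀) := (finiteDimensional_and_isGalois_ringClassField hK ι hm₀0).2
    have hw1 : primeClass m₀ w = 1 :=
      (mem_splitPrimes_ringClassField_iff hK ι hm₀0 hwm).mp (hwR (isUnramifiedIn_ringClassField hK ι hm₀0 hwm))
    intro v hℓv
    obtain ⟨σ, hσ⟩ := exists_smul_asIdeal_eq hK.1 hℓ hℓw hℓv
    exact (RingClass.primeClass_eq_one_iff_of_smul hK.1 σ m₀ hσ hwm).mpr hw1
  · -- ### `3^E ∣ ord [𝔮]_ℓ` for both `𝔮 ∣ q` (D3 at `𝔮`, transported to its conjugate)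
    have hℓ𝔮 : (ℓ : 𝓞 K) ∉ 𝔮.asIdeal := natCast_not_mem_of_natCast_mem 𝔮.isPrime.ne_top hq hℓ (Ne.symm hℓq) hq𝔮
    have hsup : 𝔮.asIdeal ⊔ Ideal.span {(ℓ : 𝓞 K)} = ⊤ := by
      refine 𝔮.isMaximal.out.2 _ (lt_of_le_of_ne le_sup_left fun heq ↦ hℓ𝔮 ?_)
      rw [heq]
      exact Ideal.mem_sup_right (Ideal.mem_span_singleton_self _)
    have h𝔮ord : 3 ^ E' ∣ orderOf (primeClass ℓ 𝔮) :=
      RingClassSplit.pow_dvd_orderOf_primeClass_of_not_rational hK hdK hℓ hℓ2 hsplit Nat.prime_three hE'1 h3E 𝔮 hsup hβ' hkum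
    intro v hqv
    obtain ⟨σ, hσ⟩ := exists_smul_asIdeal_eq hK.1 hq hq𝔮 hqv
    have hv : ¬ Ideal.span {(ℓ : 𝓞 K)} ≤ 𝔮.asIdeal := (sup_span_eq_top_iff_not_le ℓ).mp hsup
    rw [orderOf_primeClass_eq_of_smul hK.1 σ ℓ hσ hv]
    exact hEE'.trans h𝔮ord

end Summit.BirchSwinnertonDyer.BirchSwinnertonDyer.Theorems.ChebKummerThree

end
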